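import Mathlib.Tactic.Linarith
import Mathlib.Data.Finset.Max
import Summits.ValiantsHypothesis.ValiantsHypothesis.Theorems.KPlusLogSqLawTropicalBMatchingInterlacing

/-!
# Route «KPlusLogSqLaw», crux `TropicalB` (stmt-ValiantsHypothesis-19771) — TIE-TOLERANT STABILITY OF MINIMUM-WEIGHT MATCHINGS UNDER
# VERTEX DELETION (no uniqueness assumed)

HONEST FRAMING.  Helper toward the registered stubs `stub_tropThin` / `stub_tropFat` of `Cruxes/TropicalB/Lines/birth.lean`
(crux `Summit.ValiantsHypothesis.ValiantsHypothesis.Theses.KPlusLogSqLaw.TropicalB`, item stmt-ValiantsHypothesis-19771, route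
KPlusLogSqLaw; cell `pub-symmetroid`, seat val-sym-trop-p1 g8, 2026-08-27; `--supports … --as helper`).  A COMBINATORIAL ENGINE;
nothing here bounds `TropicalB` or bears on `WeakLifting`, DoorA26 / DoorA34, `MatrixDescartes` (stmt-ValiantsHypothesis-18050) or
VP ≠ VNP.

THE POINT.  At an INTEGER slope a level of the lexicographic tower of a separated design may have TIED minimisers (its thresholds are
integers), so the chain's own choice need not be unique; the counting argument (…TropicalBSeparatedThree) therefore needs the
deletion stability of …TropicalBMatchingStability in a form that assumes minimality only:

* `exists_isMin` — a minimum-weight matching (any cardinality) inside an edge set `G` exists;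
* `exists_isMin_card_le_row` / `…_col` — if `M'` is ANY minimum-weight matching inside `G` minus one row (column) then SOME
  minimum-weight matching inside `G` has at most `|M'| + 1` edges (descent along the exchange lemma);
* `exists_isMin_card_le_rows` / `…_cols` — deleting a SET `D` of rows (columns): some minimiser inside `G` has at most `|M'| + |D|`
  edges.
Combined with the monotone comparative statics in `θ` (…TropicalBMatchingNesting: ANY minimiser at a smaller slope is not larger than
ANY minimiser at a larger slope) this gives «the lower digit drops by at most one per deleted vertex» without any genericity at the
sampled slopes.  [folklore: M♮-concavity of the assignment valuation]
-/

set_option linter.dupNamespace false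
set_option autoImplicit false

namespace Summit.ValiantsHypothesis.ValiantsHypothesis.Theorems.KPlusLogSqLaw

namespace MatchingExchange

open Finset
open scoped BigOperators
open Literature.Computability.MetaComplexity.PBij

variable {α β : Type*} [DecidableEq α] [DecidableEq β]

/-- A minimum-weight matching (of any cardinality) inside `G` exists. [folklore] -/
theorem exists_isMin (G : Finset (α × β)) (w : α × β → ℤ) :
    ∃ M : Finset (α × β), IsPMatching M ∧ M ⊆ G ∧
      ∀ X : Finset (α × β), IsPMatching X → X ⊆ G → ∑ e ∈ M, w e ≤ ∑ e ∈ X, w e := by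
  classical
  set S : Finset (Finset (α × β)) := G.powerset.filter (fun X => IsPMatching X) with hS
  have hne : S.Nonempty := ⟨∅, Finset.mem_filter.2 ⟨Finset.empty_mem_powerset _, IsPMatching.empty⟩⟩
  obtain ⟨M, hM, hMmin⟩ := Finset.exists_min_image S (fun X => ∑ e ∈ X, w e) hne
  obtain ⟨hMG, hMm⟩ := Finset.mem_filter.1 hM
  exact ⟨M, hMm, Finset.mem_powerset.1 hMG, fun X hX hXG => hMmin X (Finset.mem_filter.2 ⟨Finset.mem_powerset.2 hXG, hX⟩)⟩

/-- **TIE-TOLERANT COUNT STABILITY, one ROW.**  If `M'` is a minimum-weight matching inside `G` minus row `v` and `M₀` is a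
minimum-weight matching inside `G`, then some minimum-weight matching inside `G` has at most `|M'| + 1` edges. [folklore] -/
theorem exists_isMin_card_le_row {G : Finset (α × β)} {v : α} {w : α × β → ℤ} :
    ∀ (j : ℕ) (M' M₀ : Finset (α × β)), M₀.card = j →
      IsPMatching M' → M' ⊆ G.filter (fun e => e.1 ≠ v) →
      (∀ X : Finset (α × β), IsPMatching X → X ⊆ G.filter (fun e => e.1 ≠ v) → ∑ e ∈ M', w e ≤ ∑ e ∈ X, w e) →
      IsPMatching M₀ → M₀ ⊆ G →
      (∀ X : Finset (α × β), IsPMatching X → X ⊆ G → ∑ e ∈ M₀, w e ≤ ∑ e ∈ X, w e) →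
      ∃ M : Finset (α × β), IsPMatching M ∧ M ⊆ G ∧
        (∀ X : Finset (α × β), IsPMatching X → X ⊆ G → ∑ e ∈ M, w e ≤ ∑ e ∈ X, w e) ∧ M.card ≤ M'.card + 1 := by
  intro j
  induction j using Nat.strong_induction_on with
  | _ j ih =>
    intro M' M₀ hj hM' hM'G hmin' hM₀ hM₀G hmin₀
    by_cases hle : M₀.card ≤ M'.card + 1
    · exact ⟨M₀, hM₀, hM₀G, hmin₀, hle⟩
    rw [not_le] at hle
    obtain ⟨N₁, N₂, hN₁, hN₂, hU, hI, hc, hdom, -⟩ := exchange hM' hM₀ (by omega)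
    have hG' : M' ⊆ G := hM'G.trans (Finset.filter_subset _ _)
    have hUG : M' ∪ M₀ ⊆ G := Finset.union_subset hG' hM₀G
    have hN₁G : N₁ ⊆ G := (subset_union_left hU).trans hUG
    have hN₂G : N₂ ⊆ G := (subset_union_right hU).trans hUG
    have hsum := wt_add_eq hU hI w
    have hcN := card_add_eq hU hI hc
    have hvM' : v ∉ dom M' := by
      intro hv; obtain ⟨y, hy⟩ := mem_dom.1 hv
      exact (Finset.mem_filter.1 (hM'G hy)).2 rfl
    by_cases hv : v ∈ dom N₁
    · -- `N₂` avoids `v`, so it competes with `M'`; then `N₁` is a minimiser inside `G` of size `|M'| + 1`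
      have hvN₂ : v ∉ dom N₂ := row_exclusive' hU hI hM₀ hvM' hv
      have h1 := hmin₀ N₁ hN₁ hN₁G
      have h2 := hmin' N₂ hN₂ (subset_filter_row hN₂G hvN₂)
      refine ⟨N₁, hN₁, hN₁G, fun X hX hXG => ?_, by omega⟩
      have := hmin₀ X hX hXG
      linarith
    · -- `N₁` avoids `v`, so it competes with `M'`; then `N₂` is a smaller minimiser inside `G`: descend
      have h1 := hmin' N₁ hN₁ (subset_filter_row hN₁G hv)
      have h2 := hmin₀ N₂ hN₂ hN₂G
      have hmin₂ : ∀ X : Finset (α × β), IsPMatching X → X ⊆ G → ∑ e ∈ N₂, w e ≤ ∑ e ∈ X, w e := by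
        intro X hX hXG; have := hmin₀ X hX hXG; linarith
      exact ih N₂.card (by omega) M' N₂ rfl hM' hM'G hmin' hN₂ hN₂G hmin₂

/-- **TIE-TOLERANT COUNT STABILITY, one COLUMN.** [folklore] -/
theorem exists_isMin_card_le_col {G : Finset (α × β)} {v : β} {w : α × β → ℤ} :
    ∀ (j : ℕ) (M' M₀ : Finset (α × β)), M₀.card = j →
      IsPMatching M' → M' ⊆ G.filter (fun e => e.2 ≠ v) →
      (∀ X : Finset (α × β), IsPMatching X → X ⊆ G.filter (fun e => e.2 ≠ v) → ∑ e ∈ M', w e ≤ ∑ e ∈ X, w e) →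
      IsPMatching M₀ → M₀ ⊆ G →
      (∀ X : Finset (α × β), IsPMatching X → X ⊆ G → ∑ e ∈ M₀, w e ≤ ∑ e ∈ X, w e) →
      ∃ M : Finset (α × β), IsPMatching M ∧ M ⊆ G ∧
        (∀ X : Finset (α × β), IsPMatching X → X ⊆ G → ∑ e ∈ M, w e ≤ ∑ e ∈ X, w e) ∧ M.card ≤ M'.card + 1 := by
  intro j
  induction j using Nat.strong_induction_on with
  | _ j ih =>
    intro M' M₀ hj hM' hM'G hmin' hM₀ hM₀G hmin₀
    by_cases hle : M₀.card ≤ M'.card + 1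
    · exact ⟨M₀, hM₀, hM₀G, hmin₀, hle⟩
    rw [not_le] at hle
    obtain ⟨N₁, N₂, hN₁, hN₂, hU, hI, hc, -, hrng⟩ := exchange hM' hM₀ (by omega)
    have hG' : M' ⊆ G := hM'G.trans (Finset.filter_subset _ _)
    have hUG : M' ∪ M₀ ⊆ G := Finset.union_subset hG' hM₀G
    have hN₁G : N₁ ⊆ G := (subset_union_left hU).trans hUG
    have hN₂G : N₂ ⊆ G := (subset_union_right hU).trans hUG
    have hsum := wt_add_eq hU hI w
    have hcN := card_add_eq hU hI hc
    have hvM' : v ∉ rng M' := by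
      intro hv; obtain ⟨y, hy⟩ := mem_rng.1 hv
      exact (Finset.mem_filter.1 (hM'G hy)).2 rfl
    by_cases hv : v ∈ rng N₁
    · have hvN₂ : v ∉ rng N₂ := col_exclusive' hU hI hM₀ hvM' hv
      have h1 := hmin₀ N₁ hN₁ hN₁G
      have h2 := hmin' N₂ hN₂ (subset_filter_col hN₂G hvN₂)
      refine ⟨N₁, hN₁, hN₁G, fun X hX hXG => ?_, by omega⟩
      have := hmin₀ X hX hXG
      linarith
    · have h1 := hmin' N₁ hN₁ (subset_filter_col hN₁G hv)
      have h2 := hmin₀ N₂ hN₂ hN₂G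
      have hmin₂ : ∀ X : Finset (α × β), IsPMatching X → X ⊆ G → ∑ e ∈ N₂, w e ≤ ∑ e ∈ X, w e := by
        intro X hX hXG; have := hmin₀ X hX hXG; linarith
      exact ih N₂.card (by omega) M' N₂ rfl hM' hM'G hmin' hN₂ hN₂G hmin₂

/-- **TIE-TOLERANT COUNT STABILITY, a SET of ROWS.**  If `M'` is a minimum-weight matching inside `G` minus the rows of `D`, then
some minimum-weight matching inside `G` has at most `|M'| + |D|` edges. [folklore] -/
theorem exists_isMin_card_le_rows {G : Finset (α × β)} {w : α × β → ℤ} :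
    ∀ (D : Finset α) (M' : Finset (α × β)), IsPMatching M' → M' ⊆ G.filter (fun e => e.1 ∉ D) →
      (∀ X : Finset (α × β), IsPMatching X → X ⊆ G.filter (fun e => e.1 ∉ D) → ∑ e ∈ M', w e ≤ ∑ e ∈ X, w e) →
      ∃ M : Finset (α × β), IsPMatching M ∧ M ⊆ G ∧
        (∀ X : Finset (α × β), IsPMatching X → X ⊆ G → ∑ e ∈ M, w e ≤ ∑ e ∈ X, w e) ∧ M.card ≤ M'.card + D.card := by
  intro D
  induction D using Finset.induction_on with
  | empty =>
    intro M' hM' hM'G hmin'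
    have hGG : G.filter (fun e : α × β => e.1 ∉ (∅ : Finset α)) = G := by
      ext e; simp
    rw [hGG] at hM'G hmin'
    exact ⟨M', hM', hM'G, hmin', by simp⟩
  | insert a D ha ih =>
    intro M' hM' hM'G hmin'
    -- `G − rows (insert a D) = (G − rows D) − row a`
    have hGG : G.filter (fun e : α × β => e.1 ∉ insert a D) = (G.filter (fun e : α × β => e.1 ∉ D)).filter (fun e => e.1 ≠ a) := by
      ext e; simp only [Finset.mem_filter, Finset.mem_insert, not_or]; tauto
    rw [hGG] at hM'G hmin'
    obtain ⟨M₀, hM₀, hM₀G, hmin₀⟩ := exists_isMin (G.filter (fun e : α × β => e.1 ∉ D)) w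
    obtain ⟨M₁, hM₁, hM₁G, hmin₁, hc₁⟩ := exists_isMin_card_le_row _ M' M₀ rfl hM' hM'G hmin' hM₀ hM₀G hmin₀
    obtain ⟨M, hM, hMG, hmin, hc⟩ := ih M₁ hM₁ hM₁G hmin₁
    refine ⟨M, hM, hMG, hmin, ?_⟩
    rw [Finset.card_insert_of_notMem ha]
    omega

/-- **TIE-TOLERANT COUNT STABILITY, a SET of COLUMNS.** [folklore] -/
theorem exists_isMin_card_le_cols {G : Finset (α × β)} {w : α × β → ℤ} :
    ∀ (D : Finset β) (M' : Finset (α × β)), IsPMatching M' → M' ⊆ G.filter (fun e => e.2 ∉ D) →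
      (∀ X : Finset (α × β), IsPMatching X → X ⊆ G.filter (fun e => e.2 ∉ D) → ∑ e ∈ M', w e ≤ ∑ e ∈ X, w e) →
      ∃ M : Finset (α × β), IsPMatching M ∧ M ⊆ G ∧
        (∀ X : Finset (α × β), IsPMatching X → X ⊆ G → ∑ e ∈ M, w e ≤ ∑ e ∈ X, w e) ∧ M.card ≤ M'.card + D.card := by
  intro D
  induction D using Finset.induction_on with
  | empty =>
    intro M' hM' hM'G hmin'
    have hGG : G.filter (fun e : α × β => e.2 ∉ (∅ : Finset β)) = G := by
      ext e; simp
    rw [hGG] at hM'G hmin'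
    exact ⟨M', hM', hM'G, hmin', by simp⟩
  | insert a D ha ih =>
    intro M' hM' hM'G hmin'
    have hGG : G.filter (fun e : α × β => e.2 ∉ insert a D) = (G.filter (fun e : α × β => e.2 ∉ D)).filter (fun e => e.2 ≠ a) := by
      ext e; simp only [Finset.mem_filter, Finset.mem_insert, not_or]; tauto
    rw [hGG] at hM'G hmin'
    obtain ⟨M₀, hM₀, hM₀G, hmin₀⟩ := exists_isMin (G.filter (fun e : α × β => e.2 ∉ D)) w
    obtain ⟨M₁, hM₁, hM₁G, hmin₁, hc₁⟩ := exists_isMin_card_le_col _ M' M₀ rfl hM' hM'G hmin' hM₀ hM₀G hmin₀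
    obtain ⟨M, hM, hMG, hmin, hc⟩ := ih M₁ hM₁ hM₁G hmin₁
    refine ⟨M, hM, hMG, hmin, ?_⟩
    rw [Finset.card_insert_of_notMem ha]
    omega

end MatchingExchange

end Summit.ValiantsHypothesis.ValiantsHypothesis.Theorems.KPlusLogSqLaw
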